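import Mathlib
import Literature.MathematicalPhysics.QuantumFieldTheory.Balaban1983to89.B16
import Literature.MathematicalPhysics.QuantumFieldTheory.Balaban1983to89.B10

/-!
# `Balaban1983to89.B16B10Shape` — the printed cross-reference "(0.1) … of the same type as … [16]": the bound (0.1) of
[Balaban1989LargeFieldII] against the bounds (5) of [Balaban1985UV3], as a kernel-checked DICTIONARY; the
coupling-window reading of the constants; and the step-0 normalisation obstruction to coupling-UNIFORM constants

CITATION HEADER (lean-in-tree rule 2026-08-18).  Sources (every quotation read on the x2 page renders of the audit cell
`pub-balaban`, `HOME/b2b-balaban-ref1/pages/<paper>/…-pNNN-x2.png`, not on an OCR layer):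
(B16 = [V]) T. Bałaban, *Large field renormalization. II. Localization, exponentiation, and bounds for the 𝐑 operation*,
Commun. Math. Phys. **122**, 355–392 (1989) [Balaban1989LargeFieldII] (held `paper:balaban1989-cmp122-large-field-ii`,
journal page = PDF page + 354): pp. 355–356 [1–2].  (B10 = [16] of B16) T. Bałaban, *Ultraviolet stability of
three-dimensional lattice pure gauge field theories*, Commun. Math. Phys. **102**, 255–275 (1985) [Balaban1985UV3]
(held `paper:balaban1985-cmp102-uv-stability-3d`, journal page = PDF page + 254): pp. 256–257 [2–3].  (B14 = [III])
T. Bałaban, *Convergent renormalization expansions for lattice gauge theories*, Commun. Math. Phys. **119**, 243–285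
(1988) [Balaban1988Convergent] (held `paper:balaban1988-cmp119-convergent-renormalization`, journal page = PDF page +
242): p. 249 [7] (1.15), p. 254 [12], p. 262 [20], p. 264 [22].  (B12 = [I]) T. Bałaban, *Renormalization group approach
to lattice gauge field theories. I*, Commun. Math. Phys. **109**, 249–301 (1987) [Balaban1987RG1] (journal page = PDF
page + 248): pp. 254–255 [6–7] (0.13)–(0.17), p. 259 [11] (0.31).

WHAT IS REPRODUCED (statement level; audit cell `pub-balaban`, surge node T13.2 "sharpen", unit `b2b-balaban-pv24`;
value = a TYPED SKELETON — a cross-paper statement-shape link plus hypothesis-typed bookkeeping — NOT summit progress;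
NOTHING of the series is asserted; the sibling modules `B16`, `B10`, `B14`, `B14Cor3`, `B16Cor3` are not modified).

(a) THE PRINTED TEXTS.  B16 pp. 355–356 [1–2], verbatim: *"As an immediate consequence of this theorem, we get the
ultraviolet stability bounds of the same type as for superrenormalizable models in [16]:
χ_k exp[−(1/g_k²)A(U_k) − E₋|T_η|] ≤ ρ_k ≤ exp E₊|T_η| , (0.1) with the constants E₋, E₊ independent of k, T_η, U_k."*
([16] = [Balaban1985UV3]; typed in the sibling module as `B16.UVIneq` / `B16.UV01With` / `B16.UVBound01`).  B10 p. 256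
[2], verbatim: *"χ(U) exp[−(1/g_k²)A^η(U_k(U)) − O(1)|T_1^{(k)}|] ≤ ρ_k(U) ≤ exp O(1)|T_1^{(k)}| , (5)"* with *"g_k =
g(L^kε)^{1/2}, |T_1^{(k)}| = Σ_{y∈T_1^{(k)}} 1 = Σ_{x∈T_η} η³ = (L^kε)^{−3}|T_ε|"*, p. 257 [3] line 1 *"and the constant
O(1) is independent of ε, k, g_k in a bounded set."*, p. 256 after (4) *"The constant O(1) goes to ∞ as g → 0."*, and
remark (6) p. 257: *"The bounds (5) imply bounds for partition functions … ∫dU ρ_k = ∫dU T^k ρ₀ = ∫dU ρ₀ = Z^ε, (6)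
they imply uniform in ε bounds for the partition function Z^ε."* (typed in the sibling module as `B10.Bounds5`,
`B10.Bounds5At`, `B10.Thm1Printed`, `B10.Thm1PrintedCompact`, `B10.partition_upper`).  B14 p. 264 [22] Cor. 3:
*"constants E₋, E₊ independent of η and T, but depending on g_k"* (`B16.Cor3With` / `B16.Cor3_250`).

(b) THE DICTIONARY (§1).  `toB10` sends one d = 4 run (`B16.RunData`, K steps) to the B10 statement carrier:
`|T_η| ↦ |T_1^{(k)}|` (both = the number of sites of the current unit lattice, cell GAPS C-adv3-6), `(E₋, E₊) ↦ O(1)`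
(ONE constant on both sides of (5); two on the sides of (0.1) — merged by `max`, which needs only χ_k ≥ 0,
`B16.SignConventions`), "ρ_k has the form of Sect. 2 [III]" ↦ "ρ_k satisfies (41), (47)" (the respective Theorem-2-type
conclusions, both abstract).  Kernel facts: (5) at step k for `toB10 D K` IS (0.1) at step k with E₋ = E₊ (`bounds5At_iff`,
`bounds5_iff_uv01`); (0.1) in its printed dependence clause (`B16.UVBound01`: γ, E± chosen before the run, the step and
the configuration) is EQUIVALENT to B10's Theorem-1 SHAPE `B10.Thm1Printed` on the family of runs with couplings in
]0, γ] (`uvBound01_iff_thm1B10`); B16's Theorem 1 is B10's Theorem-2 shape on that family (`thm1_iff_thm2B10`); hence the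
sentence "an immediate consequence of this theorem … of the same type as [16]" has exactly the type of B10's Sect. D
leaf `B10.Thm1OfThm2Leaf` transported to d = 4 (`uvBound01_of_thm1_of_leafShape`) — whose d = 4 content is [III] Cor. 3
+ [V] p. 387, cell GAPS G-r2.5/G-r2.5a, G-r2.7, G-B16-08, G-adv3-1/2, modules `B14Cor3`, `B16Cor3` (not touched here);
remark (6)'s upper half transports verbatim (`partitionUpper_of_uv01With`).

(c) THE COUPLING CLAUSE (§2).  (0.1) says "independent of k, T_η, U_k" and is silent on the coupling; (5) says "g_k in a
bounded set" and "goes to ∞ as g → 0"; (2.50) says "depending on g_k".  The reading all three support is typed as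
`UVBound01Compact` (for every compact coupling window [g_min, γ] ⊂ ]0, γ] one pair E± serves every run, step and
configuration whose g_k lies in the window) — the d = 4 twin of `B10.Thm1PrintedCompact` (cell GAPS G-B10-01), and
EQUIVALENT to it through the dictionary (`uvCompact_iff_thm1CompactB10`); it follows from [III]'s form as soon as the
dependence functions e±(·) are bounded on compact windows, e.g. continuous on the HALF-OPEN ]0, γ]
(`uvCompact_of_cor3_continuousOn_Ioc`; contrast the sibling `B16.uvBound01_of_cor3_continuousOn`, which needs [0, γ]).

(d) THE STEP-0 OBSTRUCTION (§3; cell GAPS G-pv24-1, the d = 4 twin of G-B10-01's "check at k = 0").  [III] Thm 1 p. 262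
[20]: *"the sequence of densities {ρ_k}, generated by successive applications of the operations 𝐑T to the density
ρ₀ = exp[−(1/g₀²)A − E]"*; p. 262: *"The constant E_k (depending on {Ω_j}, {Λ_j} also) is obtained by subtracting
one-step vacuum energy expressions, generated in small field regions, from the initial constant E. This initial constant
is defined in fact as a sum of all such expressions for all the lattices T^{(k)} as the small field regions. The
constant E₁ was defined in Sect. 1"*; p. 254 [12]: *"The constant E₁ is obtained from E by subtraction of all the
constants which have appeared in the procedure, i.e., the constants in the first exponential in (1.15), and the constant
E^{(1)}(Λ₁, g₀, 1)."*; (1.15) p. 249 [7], first exponential: *"exp[−(1/g₀²)A(U₁) + log g₀ d(𝐠)|Ω₁*| + log σ₀|Ω₁*| −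
log z(L⁴ − 1)|Ω₁^{(1)}| − E]"* with *"The number |Ω₁*| is the number of bonds belonging to Ω₁ minus the number of bonds
in the set {b₀(c) : c ∈ Ω₁^{(1)}}"* and *"Now we perform the scaling transformation A = g₀A′"*; the same one-step
logarithm is displayed in B16 itself, p. 356 [2]: *"= exp[−(1/g_k²)A(ζ₀, U₀) + (−½d(g) log g_k⁻² + log σ₀)|Λ^{(k)}∖G₀|]"*.
So at the unit configuration ρ₀(1) = e^{−E} and −E carries, from the scale-0 expression alone, `d(𝔤) log g₀⁻¹ ·
(#bonds(T) − #bonds(T^{(1)}))` minus the g₀-logarithm of `z^{(L⁴−1)|T^{(1)}|}` (z = the gauge-fixing normalisation of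
(0.15)–(0.17) [I]) — net `c·|T_1^{(0)}| log g₀⁻¹` with c = 3(1 − L⁻⁴)d(𝔤) by the count of integrated transversal
dimensions (4(1 − L⁻⁴)d(𝔤) if z is g-independent), the scales j ≥ 1 adding terms of the same sign — UNLESS the
remaining printed pieces (log σ₀, the O(1) of log z, E^{(k+1)}(T^{(k+1)}, g_k, 1) — cf. [I] p. 258: *"there is one more
renormalization counterterm needed, it is a vacuum energy counterterm. It is contained in the normalization factors in
the integrals (0.17), (0.19)"*) compensate, which is the question put to the author in G-pv24-1.  This module does NOT assert that count: it is typed as the HYPOTHESIS `UnitConfigLog D c C₀`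
("some step-0 configuration has ρ₀ ≥ exp((c log g₀⁻¹ − C₀)|T_1^{(0)}|)"), and the kernel content is what (0.1) then
forces: `E₊ ≥ c log g₀⁻¹ − C₀` (`ep_lower_of_uvIneq_zero`), hence a floor `g₀ ≥ exp(−(E₊ + C₀)/c)` under coupling-uniform
constants (`g0_floor_of_uvIneq_zero`, `uv01With_forces_g0_floor`), hence a ceiling on the number K of renormalization
steps along any flow of the (0.31) [I] shape `1/g₀² ≥ a + bK` (`steps_le_of_uvIneq_zero`), hence `¬ B16.UVBound01` for a
construction whose family contains runs with arbitrarily small bare coupling (`not_uvBound01_of_smallCouplings`) —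
while the window reading (c) and [III]'s "depending on g_k" are untouched, with `e₊(g₀) ≥ c log g₀⁻¹ − C₀` along the
occurring couplings (`ep_unbounded_of_cor3`: the d = 4 twin of B10's "The constant O(1) goes to ∞ as g → 0").  The same
three lines over the B10 carrier make G-B10-01's prose check kernel (`b10_O1_lower_of_bounds5At_zero`).

(e) THE STEP-0 LOGARITHM FROM THE LEAVES (§4, revision v2).  The hypothesis `UnitConfigLog` is DERIVED by real
arithmetic (`CountertermData.negE_lower`, `unitConfigLog_of_leaves`, `ep_lower_of_leaves`) from the located leaves —
(1.15)'s one-step constants at every scale (`OneStep115`), E = their sum (`ESum`, p. 262), L⁴-blocking of the site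
numbers (`Blocking`), couplings in ]0, 1] (`SmallCouplings`) — plus THREE READER'S ITEMS explicitly labelled: the
bond count |T^{(j)*}| = 4(|T₁^{(j)}| − |T₁^{(j+1)}|) for the whole lattice (`TstarCount`), the elementary LOWER Laplace
bound log z ≥ d(𝔤) log g_j − C_z for the gauge-fixing normalisation of (0.14)–(0.17) [I] (`ZLower`; a larger z only
improves the bound), and the one-sided volume bound E^{(j+1)}(T^{(j+1)}, g_j, 1) ≤ C_E|T₁^{(j+1)}| (`EflBound`; author
question (ii) of G-pv24-1 — located support [I] (2.14) p. 268 `log N″_k = E^{(k+1)}(g_k, 1)`, N″_k a normalised Gaussian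
expectation of χ_k·exp[an expression vanishing at g_k = 0]; [I] p. 258 then normalises the constant away, [III] p. 254
carries it into E).  Result: −E ≥
(3(1 − L⁻⁴)d(𝔤) log g₀⁻¹ − C₀)|T₁^{(0)}| with C₀ = 4|log σ₀| + C_z + C_E/(L⁴ − 1), hence E₊ ≥ 3(1 − L⁻⁴)d(𝔤) log g₀⁻¹ − C₀
under (0.1) at k = 0 (SU(2), L = 2: coefficient 135/16).

(f) THE BY-NAME BRIDGE TO THE BARE-COUPLING READING (§5, revision v2.2, append-only).  The sibling `B16` (v7/v8)
types the reading of (0.1)'s clause with E± depending only on the bare coupling g₀ of the run (`B16.UVBound01PerBare`)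
and proves it from the compact-window statement under the flow inequality (2.6) of [III] p. 255 — with the window
hypothesis UNFOLDED (`B16.uvBound01PerBare_of_window_floor`), since `B16` cannot import this module.  §5 folds it back
BY NAME: `UVBound01Compact C` + the (2.6)-floor (∀ k ≤ K, g_0 ≤ (1+β₀) g_k along every run of the ]0, γ]-family, a
HYPOTHESIS — printed, unproved in print, the cell's located step (i) `B14.FlowIneq26`) ⇒ `B16.UVBound01PerBare C`
(`uvPerBare_of_uvCompact_floor`; fixed-γ form `uvPerBare_of_window_floor`; chain to the per-run reading
`uvPerRun_of_uvCompact_floor`), so that the ordering `B16.UVBound01 ⇒ UVBound01Compact ⇒[(2.6)-floor] B16.UVBound01PerBare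
⇒ B16.UVBound01PerRun` is a chain of NAMED kernel theorems; the floor is load-bearing (`B16PerBareCounter.compact_not_implies_perBare`,
reader group r2, not imported here).  Of the three reader's items of (e), `ZLower` is discharged for G = U(N), SU(N)
in the sibling `B16ZLower` and `TstarCount` in the sibling `B16TstarCount` (both import this module; nothing here
changes); `EflBound` remains (author question (ii) of G-pv24-1).

Every `def … : Prop` is a quoted leaf or an explicitly labelled HYPOTHESIS; every `theorem` is quantifier bookkeeping or
real arithmetic (no analytic content, no content of the series).  Cell records: GAPS.md G-pv24-1 (new), C-pv24-1
(the cross-reference reading certified as a SHAPE identity), DIVERGENCE.md D-pv24.1 (the dictionary) and D3 (the two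
dependence clauses); the legacy strong reading `B16.UVBound01` is NOT deleted (D-b10.3-style supersession is the tenure
reader's call, not this module's).
-/

namespace Literature.MathematicalPhysics.QuantumFieldTheory.Balaban1983to89.B16B10Shape

open Literature.MathematicalPhysics.QuantumFieldTheory.Balaban1983to89

/-! ## §1. The dictionary (0.1) [V] ↔ (5) [16] -/

/-- The dictionary: one d = 4 run of `K` steps, read on the statement carrier of [Balaban1985UV3]: same configurations,
densities, characteristic functions and background Wilson action; `sites k = |T_1^{(k)}| = numSites k` (B10 p. 256:
*"|T_1^{(k)}| = Σ_{y∈T_1^{(k)}} 1 = Σ_{x∈T_η} η³"*; B16's |T_η| is the same number, cell GAPS C-adv3-6); `g = g_k`;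
"(41), (47) hold" ↦ "ρ_k has the form of Sect. 2 [III]". [cite: Balaban1985UV3, (5) p.256] -/
def toB10 (D : B16.RunData) (K : ℕ) : B10.RunData where
  K := K
  Cfg := D.Cfg
  ρ := D.ρ
  χ := D.χ
  wilsonBG := D.wilsonBG
  sites := fun k => (D.numSites k : ℝ)
  g := D.flow.g
  Ineq41_47 := D.Sect2Form

/-- The family of runs of a d = 4 construction whose couplings lie in ]0, γ] up to their last step — the hypothesis of
B16 Theorem 1 (*"If the sequence of the effective coupling constants is contained in an interval ]0, γ]"*, p. 355). [cite: Balaban1989LargeFieldII, Thm 1 p.355] -/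
abbrev Family (C : B16.Construction) (γ : ℝ) : Type :=
  {P : B12.RunParams // (C P).flow.InInterval γ P.K}

/-- The family `Family C γ` read through the dictionary, as a B10-type family of runs. [folklore] -/
abbrev runsB10 (C : B16.Construction) (γ : ℝ) : Family C γ → B10.RunData :=
  fun P => toB10 (C P.1) P.1.K

/-- (5) at step k for the transported run IS (0.1) at step k with `E₋ = E₊ = O(1)` (the only difference in print is
`(1/g_k²)` vs `g_k⁻²`). [cite: Balaban1985UV3, (5) p.256] -/
theorem bounds5At_iff (D : B16.RunData) (K : ℕ) (O1 : ℝ) (k : ℕ) :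
    B10.Bounds5At (toB10 D K) O1 k ↔ ∀ V : D.Cfg k, B16.UVIneq D k V O1 O1 := by
  unfold B10.Bounds5At B16.UVIneq
  refine forall_congr' fun V => ?_
  show (D.χ k V * Real.exp (-((D.flow.g k)⁻¹ ^ 2 * D.wilsonBG k V) - O1 * (D.numSites k : ℝ)) ≤ D.ρ k V ∧
      D.ρ k V ≤ Real.exp (O1 * (D.numSites k : ℝ))) ↔
    (D.χ k V * Real.exp (-(1 / (D.flow.g k) ^ 2 * D.wilsonBG k V) - O1 * (D.numSites k : ℝ)) ≤ D.ρ k V ∧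
      D.ρ k V ≤ Real.exp (O1 * (D.numSites k : ℝ)))
  rw [inv_pow, one_div]

/-- (5) for all `k ≤ K` IS (0.1) for all `k ≤ K` with equal constants. [cite: Balaban1985UV3, (5) p.256] -/
theorem bounds5_iff_uv01 (D : B16.RunData) (K : ℕ) (O1 : ℝ) :
    B10.Bounds5 (toB10 D K) O1 ↔ ∀ k, k ≤ K → ∀ V : D.Cfg k, B16.UVIneq D k V O1 O1 := by
  rw [B10.bounds5_iff]
  exact forall_congr' fun k => imp_congr_right fun _ => bounds5At_iff D K O1 k

/-- Monotonicity of (0.1) in its two constants, given `χ_k ≥ 0` and `|T_η| ≥ 0`: larger `E₋, E₊` are weaker.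
Elementary. [folklore] -/
theorem uvIneq_mono (D : B16.RunData) (k : ℕ) (V : D.Cfg k) {Em Ep Em' Ep' : ℝ}
    (hχ : 0 ≤ D.χ k V) (h : B16.UVIneq D k V Em Ep) (hm : Em ≤ Em') (hp : Ep ≤ Ep') :
    B16.UVIneq D k V Em' Ep' := by
  obtain ⟨hlow, hup⟩ := h
  have hvol : (0 : ℝ) ≤ (D.numSites k : ℝ) := Nat.cast_nonneg _
  refine ⟨le_trans (mul_le_mul_of_nonneg_left (Real.exp_le_exp.mpr ?_) hχ) hlow,
    le_trans hup (Real.exp_le_exp.mpr ?_)⟩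
  · have := mul_le_mul_of_nonneg_right hm hvol
    linarith
  · exact mul_le_mul_of_nonneg_right hp hvol

/-- Merging the two constants of (0.1) into the one constant of (5): `O(1) = max(E₋, E₊)`. [folklore] -/
theorem bounds5_of_uv01 (D : B16.RunData) (K : ℕ) (Em Ep : ℝ) (hχ : ∀ k V, 0 ≤ D.χ k V)
    (h : ∀ k, k ≤ K → ∀ V : D.Cfg k, B16.UVIneq D k V Em Ep) :
    B10.Bounds5 (toB10 D K) (max Em Ep) :=
  (bounds5_iff_uv01 D K (max Em Ep)).mpr fun k hk V =>
    uvIneq_mono D k V (hχ k V) (h k hk V) (le_max_left _ _) (le_max_right _ _)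

/-- (0.1) with γ, E± fixed (`B16.UV01With`) gives B10's Theorem-1 SHAPE on the ]0, γ]-family, with `O(1) = max(E₋, E₊)`
serving every "bounded set" (the family's couplings are ≤ γ anyway). [cite: Balaban1985UV3, Thm 1 p.257] -/
theorem thm1B10_of_uv01With (C : B16.Construction) (γ Em Ep : ℝ) (hsign : B16.SignConventions C)
    (h : B16.UV01With C γ Em Ep) : B10.Thm1Printed (runsB10 C γ) := by
  intro gmax _
  refine ⟨max Em Ep, fun P _ => ?_⟩
  exact bounds5_of_uv01 (C P.1) P.1.K Em Ep (fun k V => hsign P.1 k V) (fun k hk V => h P.1 P.2 k hk V)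

/-- Conversely B10's Theorem-1 shape on the ]0, γ]-family gives (0.1) with `E₋ = E₊ = O(1)(γ)`. [cite: Balaban1985UV3, Thm 1 p.257] -/
theorem uv01With_of_thm1B10 (C : B16.Construction) (γ : ℝ) (hγ : 0 < γ)
    (h : B10.Thm1Printed (runsB10 C γ)) : ∃ O1 : ℝ, B16.UV01With C γ O1 O1 := by
  obtain ⟨O1, hO1⟩ := h γ hγ
  refine ⟨O1, fun P hP k hk V => ?_⟩
  have hB : B10.Bounds5 (runsB10 C γ ⟨P, hP⟩) O1 := hO1 ⟨P, hP⟩ fun k hk => hP k hk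
  exact (bounds5_iff_uv01 (C P) P.K O1).mp hB k hk V

/-- **(0.1) ≙ Theorem 1 [16] in shape.**  The printed dependence clause of (0.1) (*"E₋, E₊ independent of k, T_η, U_k"*,
under Theorem 1's *"contained in an interval ]0, γ]"*) is EQUIVALENT, given only `χ_k ≥ 0`, to B10's Theorem 1 as typed
(`B10.Thm1Printed`: for every bounded set of couplings one constant for all lattice approximations and all k) on the
]0, γ]-family of runs.  This is the exact sense of "of the same type as … [16]". [cite: Balaban1989LargeFieldII, (0.1) pp.355–356] -/
theorem uvBound01_iff_thm1B10 (C : B16.Construction) (hsign : B16.SignConventions C) :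
    B16.UVBound01 C ↔ ∃ γ : ℝ, 0 < γ ∧ B10.Thm1Printed (runsB10 C γ) := by
  constructor
  · rintro ⟨γ, hγ, Em, Ep, h⟩
    exact ⟨γ, hγ, thm1B10_of_uv01With C γ Em Ep hsign h⟩
  · rintro ⟨γ, hγ, h⟩
    obtain ⟨O1, hO1⟩ := uv01With_of_thm1B10 C γ hγ h
    exact ⟨γ, hγ, O1, O1, hO1⟩

/-- B16's Theorem 1 (*"the effective densities ρ_k have the form, and satisfy all the conditions and bounds, described in
Sect. 2 [III]"*, for couplings in ]0, γ]) IS B10's Theorem-2 shape (*"satisfies the inequalities (41), (47)"* for every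
run and step) on the ]0, γ]-family, through the dictionary. [cite: Balaban1989LargeFieldII, Thm 1 p.355] -/
theorem thm1_iff_thm2B10 (C : B16.Construction) :
    B16.Thm1Printed C ↔ ∃ γ : ℝ, 0 < γ ∧ B10.Thm2Printed (runsB10 C γ) := by
  constructor
  · rintro ⟨γ, hγ, h⟩
    exact ⟨γ, hγ, fun P k hk => h P.1 P.2 k hk⟩
  · rintro ⟨γ, hγ, h⟩
    exact ⟨γ, hγ, fun P hP k hk => h ⟨P, hP⟩ k hk⟩

/-- **"As an immediate consequence of this theorem"** (p. 355), typed: IF the d = 4 family satisfies an implication of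
the shape of B10's Sect. D leaf (`B10.Thm1OfThm2Leaf`: Theorem 2 ⇒ Theorem 1, pp. 272–275 of [16]) on every ]0, γ]-family,
THEN B16's Theorem 1 gives (0.1).  The d = 4 content of that leaf is [III] Cor. 3 + [V] p. 387 (cell modules `B14Cor3`,
`B16Cor3`; GAPS G-r2.5a, G-r2.7, G-B16-08) — an input here, not a claim. [cite: Balaban1989LargeFieldII, (0.1) p.355] -/
theorem uvBound01_of_thm1_of_leafShape (C : B16.Construction) (hsign : B16.SignConventions C)
    (hleaf : ∀ γ : ℝ, 0 < γ → B10.Thm1OfThm2Leaf (runsB10 C γ)) (h1 : B16.Thm1Printed C) :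
    B16.UVBound01 C := by
  obtain ⟨γ, hγ, h2⟩ := (thm1_iff_thm2B10 C).mp h1
  exact (uvBound01_iff_thm1B10 C hsign).mpr ⟨γ, hγ, hleaf γ hγ h2⟩

/-- Remark **(6)** of [16] (*"The bounds (5) imply bounds for partition functions"*), upper half, transported verbatim:
for any monotone normalised functional `Int` on step-k configurations, (0.1) gives `∫ρ_k ≤ exp(E₊|T_η|)`.  (B16 prints
no counterpart of (6); [III]'s is (2.49)–(2.50) + "Thus we estimate the integral ∫dV_kρ_k", p. 264.)  Bookkeeping via
`B10.partition_upper`. [cite: Balaban1985UV3, (6) p.257] -/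
theorem partitionUpper_of_uv01With (C : B16.Construction) (γ Em Ep : ℝ) (h : B16.UV01With C γ Em Ep)
    (P : B12.RunParams) (hP : (C P).flow.InInterval γ P.K) (k : ℕ) (hk : k ≤ P.K)
    (Int : ((C P).Cfg k → ℝ) → ℝ) (mono : ∀ f g : (C P).Cfg k → ℝ, (∀ x, f x ≤ g x) → Int f ≤ Int g)
    (const : ∀ a : ℝ, Int (fun _ => a) = a) :
    Int ((C P).ρ k) ≤ Real.exp (Ep * ((C P).numSites k : ℝ)) :=
  B10.partition_upper _ Int _ _ mono const fun V => (h P hP k hk V).2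

/-! ## §2. The coupling clause: the compact-window reading (d = 4 twin of `B10.Thm1PrintedCompact`) -/

/-- (0.1) for fixed γ on the coupling WINDOW `[gmin, γ]`: one pair `E₋, E₊` for every run of the ]0, γ]-family, every step
`k ≤ K` whose coupling satisfies `gmin ≤ g_k`, and every configuration — (0.1)'s "independent of k, T_η, U_k" together
with (5)'s "g_k in a bounded set" read as a compact subset of (0, ∞) (cell GAPS G-B10-01) and (2.50)'s "depending on
g_k". [cite: Balaban1989LargeFieldII, (0.1) p.356] -/
def UV01Window (C : B16.Construction) (γ gmin Em Ep : ℝ) : Prop :=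
  ∀ P : B12.RunParams, (C P).flow.InInterval γ P.K → ∀ k, k ≤ P.K → gmin ≤ (C P).flow.g k →
    ∀ V : (C P).Cfg k, B16.UVIneq (C P) k V Em Ep

/-- **(0.1), compact-window reading**: ∃ γ > 0 such that for every `0 < gmin ≤ γ` there are `E₋, E₊` with `UV01Window`.
The reading supported by all three printed clauses ((0.1) p. 356, (5) pp. 256–257, (2.50) p. 264); strictly weaker than
`B16.UVBound01` (`uvCompact_of_uvBound01`); under the hypotheses of §3 uniformity down to g = 0 fails, so this is the
coupling-uniformity the printed normalisation of ρ₀ leaves room for. [cite: Balaban1989LargeFieldII, (0.1) pp.355–356] -/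
def UVBound01Compact (C : B16.Construction) : Prop :=
  ∃ γ : ℝ, 0 < γ ∧ ∀ gmin : ℝ, 0 < gmin → gmin ≤ γ → ∃ Em Ep : ℝ, UV01Window C γ gmin Em Ep

/-- The strong reading implies the window reading (forget the window). [folklore] -/
theorem uvCompact_of_uvBound01 (C : B16.Construction) (h : B16.UVBound01 C) : UVBound01Compact C := by
  obtain ⟨γ, hγ, Em, Ep, h⟩ := h
  exact ⟨γ, hγ, fun gmin _ _ => ⟨Em, Ep, fun P hP k hk _ V => h P hP k hk V⟩⟩

/-- [III]'s form (`B16.Cor3With`: constants `e_±(g_k)`) gives (0.1) on the window `[gmin, γ]` as soon as `e_±` are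
bounded above there.  Bookkeeping (`uvIneq_mono`). [folklore] -/
theorem uvWindow_of_cor3 (C : B16.Construction) (γ gmin : ℝ) (em ep : ℝ → ℝ) (Em Ep : ℝ)
    (hsign : B16.SignConventions C) (hcor : B16.Cor3With C γ em ep)
    (hm : ∀ x, gmin ≤ x → x ≤ γ → em x ≤ Em) (hp : ∀ x, gmin ≤ x → x ≤ γ → ep x ≤ Ep) :
    UV01Window C γ gmin Em Ep := by
  intro P hP k hk hmin V
  have hle : (C P).flow.g k ≤ γ := (hP k hk).2
  exact uvIneq_mono (C P) k V (hsign P k V) (hcor P hP k hk V) (hm _ hmin hle) (hp _ hmin hle)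

/-- **The window reading from [III] Cor. 3 with dependence functions continuous on the HALF-OPEN interval ]0, γ]** —
no behaviour at 0 is needed (compactness of `[gmin, γ] ⊂ ]0, γ]`).  Contrast `B16.uvBound01_of_cor3_continuousOn`
(sibling module), whose hypothesis is continuity on the CLOSED `[0, γ]`, i.e. boundedness near g = 0 — which §3 shows
the printed normalisation of ρ₀ does not allow for `e₊`. [folklore] -/
theorem uvCompact_of_cor3_continuousOn_Ioc (C : B16.Construction) (hsign : B16.SignConventions C)
    (h : ∃ γ : ℝ, 0 < γ ∧ ∃ em ep : ℝ → ℝ, B16.Cor3With C γ em ep ∧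
      ContinuousOn em (Set.Ioc 0 γ) ∧ ContinuousOn ep (Set.Ioc 0 γ)) :
    UVBound01Compact C := by
  obtain ⟨γ, hγ, em, ep, hcor, hem, hep⟩ := h
  refine ⟨γ, hγ, fun gmin hmin _ => ?_⟩
  have hsub : Set.Icc gmin γ ⊆ Set.Ioc 0 γ := fun x hx => ⟨lt_of_lt_of_le hmin hx.1, hx.2⟩
  obtain ⟨Em, hEm⟩ := isCompact_Icc.bddAbove_image (hem.mono hsub)
  obtain ⟨Ep, hEp⟩ := isCompact_Icc.bddAbove_image (hep.mono hsub)
  exact ⟨Em, Ep, uvWindow_of_cor3 C γ gmin em ep Em Ep hsign hcor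
    (fun x h1 h2 => hEm ⟨x, ⟨h1, h2⟩, rfl⟩) (fun x h1 h2 => hEp ⟨x, ⟨h1, h2⟩, rfl⟩)⟩

/-- The window reading IS B10's audit reading `B10.Thm1PrintedCompact` (*"the constant O(1) is independent of ε, k, g_k in
a bounded set"* with "bounded set" = compact subset of (0, ∞), cell GAPS G-B10-01) on the ]0, γ]-family, through the
dictionary — given `χ_k ≥ 0`. [cite: Balaban1985UV3, Thm 1 p.257] -/
theorem uvCompact_iff_thm1CompactB10 (C : B16.Construction) (hsign : B16.SignConventions C) :
    UVBound01Compact C ↔ ∃ γ : ℝ, 0 < γ ∧ B10.Thm1PrintedCompact (runsB10 C γ) := by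
  constructor
  · rintro ⟨γ, hγ, h⟩
    refine ⟨γ, hγ, fun gmin gmax hmin _ => ?_⟩
    by_cases hle : gmin ≤ γ
    · obtain ⟨Em, Ep, hW⟩ := h gmin hmin hle
      refine ⟨max Em Ep, fun P k hk h1 _ => ?_⟩
      exact (bounds5At_iff (C P.1) P.1.K (max Em Ep) k).mpr fun V =>
        uvIneq_mono (C P.1) k V (hsign P.1 k V) (hW P.1 P.2 k hk h1 V) (le_max_left _ _) (le_max_right _ _)
    · refine ⟨0, fun P k hk h1 _ => ?_⟩
      exact absurd (le_trans h1 (P.2 k hk).2) hle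
  · rintro ⟨γ, hγ, h⟩
    refine ⟨γ, hγ, fun gmin hmin hle => ?_⟩
    obtain ⟨O1, hO1⟩ := h gmin γ hmin hle
    refine ⟨O1, O1, fun P hP k hk h1 V => ?_⟩
    exact (bounds5At_iff (C P) P.K O1 k).mp (hO1 ⟨P, hP⟩ k hk h1 (hP k hk).2) V

/-! ## §3. The step-0 normalisation obstruction to coupling-uniform constants (cell GAPS G-pv24-1)

Nothing below asserts the printed count; it is carried as the hypothesis `UnitConfigLog`, and the theorems are what the
upper half of (0.1) at k = 0 then forces.  Over the B10 carrier the same lines make the prose check of G-B10-01 kernel. -/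

/-- HYPOTHESIS (typed from print, NOT asserted): at step 0 some configuration — in print the unit configuration `U = 1`,
where `A(1) = 0`, `χ₀(1) = 1` and `ρ₀(1) = e^{−E}` by [III] Thm 1 p. 262 *"ρ₀ = exp[−(1/g₀²)A − E]"* — has density at
least `exp((c·log g₀⁻¹ − C₀)·|T_1^{(0)}|)`.  The printed source of the logarithm: E is *"a sum of all such [one-step
vacuum energy] expressions for all the lattices T^{(k)} as the small field regions"* (p. 262), the scale-0 expression
being *"the constants in the first exponential in (1.15), and the constant E^{(1)}(Λ₁, g₀, 1)"* (p. 254), and (1.15)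
p. 249 displays them: *"+ log g₀ d(𝐠)|Ω₁*| + log σ₀|Ω₁*| − log z(L⁴ − 1)|Ω₁^{(1)}|"* (produced by *"the scaling
transformation A = g₀A′"*); B16 p. 356 displays the same one-step term *"(−½d(g) log g_k⁻² + log σ₀)|Λ^{(k)}∖G₀|"*.
The net coefficient `c` (= 3(1 − L⁻⁴)d(𝔤) by the count of integrated transversal dimensions, z being the g₀-dependent
gauge-fixing normalisation of (0.15)–(0.17) [I]) and the constant `C₀` (log σ₀, the O(1) of log z, sup_{g≤γ} of
E^{(k+1)}(T^{(k+1)}, g, 1)/|T^{(k+1)}|, summed over scales with ratio L⁻⁴) are for the author to confirm (cell GAPS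
G-pv24-1); here they are parameters. [cite: Balaban1988Convergent, (1.15) p.249] -/
def UnitConfigLog (D : B16.RunData) (c C₀ : ℝ) : Prop :=
  ∃ V₁ : D.Cfg 0, Real.exp ((c * Real.log (D.flow.g 0)⁻¹ - C₀) * (D.numSites 0 : ℝ)) ≤ D.ρ 0 V₁

/-- **What (0.1) at k = 0 forces.**  If the step-0 density reaches `exp((c log g₀⁻¹ − C₀)|T_1^{(0)}|)` somewhere and the
lattice is non-empty, the upper half of (0.1) at step 0 with constant `E₊` gives `c·log g₀⁻¹ − C₀ ≤ E₊`.  Real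
arithmetic (monotonicity of exp). [folklore] -/
theorem ep_lower_of_uvIneq_zero (D : B16.RunData) (c C₀ Em Ep : ℝ) (hN : 0 < (D.numSites 0 : ℝ))
    (hlog : UnitConfigLog D c C₀) (h01 : ∀ V : D.Cfg 0, B16.UVIneq D 0 V Em Ep) :
    c * Real.log (D.flow.g 0)⁻¹ - C₀ ≤ Ep := by
  obtain ⟨V₁, hV₁⟩ := hlog
  have h := le_trans hV₁ (h01 V₁).2
  rw [Real.exp_le_exp] at h
  exact le_of_mul_le_mul_right h hN

/-- Hence a FLOOR on the bare coupling under coupling-uniform constants: `g₀ ≥ exp(−(E₊ + C₀)/c)` (c > 0, g₀ > 0).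
Real arithmetic. [folklore] -/
theorem g0_floor_of_uvIneq_zero (D : B16.RunData) (c C₀ Em Ep : ℝ) (hc : 0 < c) (hg : 0 < D.flow.g 0)
    (hN : 0 < (D.numSites 0 : ℝ)) (hlog : UnitConfigLog D c C₀) (h01 : ∀ V : D.Cfg 0, B16.UVIneq D 0 V Em Ep) :
    Real.exp (-((Ep + C₀) / c)) ≤ D.flow.g 0 := by
  have h := ep_lower_of_uvIneq_zero D c C₀ Em Ep hN hlog h01
  rw [Real.log_inv] at h
  have h1 : -Real.log (D.flow.g 0) ≤ (Ep + C₀) / c := by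
    rw [le_div_iff₀ hc]
    linarith
  have hlog' : -((Ep + C₀) / c) ≤ Real.log (D.flow.g 0) := by linarith
  exact (Real.le_log_iff_exp_le hg).mp hlog'

/-- Hence a CEILING on the number of renormalization steps along any flow of the asymptotically-free shape of (0.31) [I]
(*"1/g² + β log(L^kε)⁻¹ ≤ 1/g_k²"*, at k = 0 with ε = L^{−K}: `1/g₀² ≥ a + b·K`, b = β log L > 0): (0.1) at k = 0 with
coupling-uniform `E₊` bounds `K ≤ (exp(2(E₊ + C₀)/c) − a)/b` — no continuum limit K → ∞ inside one pair of constants.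
Real arithmetic. [cite: Balaban1987RG1, (0.31) p.259] -/
theorem steps_le_of_uvIneq_zero (D : B16.RunData) (c C₀ Em Ep a b : ℝ) (K : ℕ) (hc : 0 < c) (hb : 0 < b)
    (hg : 0 < D.flow.g 0) (hN : 0 < (D.numSites 0 : ℝ)) (hlog : UnitConfigLog D c C₀)
    (h01 : ∀ V : D.Cfg 0, B16.UVIneq D 0 V Em Ep) (hAF : a + b * (K : ℝ) ≤ 1 / (D.flow.g 0) ^ 2) :
    (K : ℝ) ≤ (Real.exp (2 * ((Ep + C₀) / c)) - a) / b := by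
  have hfloor := g0_floor_of_uvIneq_zero D c C₀ Em Ep hc hg hN hlog h01
  have hpos : 0 < Real.exp (-((Ep + C₀) / c)) := Real.exp_pos _
  have hsq : Real.exp (-((Ep + C₀) / c)) ^ 2 ≤ (D.flow.g 0) ^ 2 :=
    pow_le_pow_left₀ hpos.le hfloor 2
  have hinv : 1 / (D.flow.g 0) ^ 2 ≤ 1 / Real.exp (-((Ep + C₀) / c)) ^ 2 :=
    one_div_le_one_div_of_le (pow_pos hpos 2) hsq
  have hexp : 1 / Real.exp (-((Ep + C₀) / c)) ^ 2 = Real.exp (2 * ((Ep + C₀) / c)) := by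
    rw [sq, ← Real.exp_add, one_div, ← Real.exp_neg]
    congr 1
    ring
  rw [hexp] at hinv
  rw [le_div_iff₀ hb]
  have := le_trans hAF hinv
  linarith

/-- HYPOTHESIS at the level of a construction: the step-0 logarithm with constants `c, C₀` UNIFORM over the ]0, γ]-family
(the printed c = 3(1 − L⁻⁴)d(𝔤) does not depend on the run; C₀ = C₀(γ) collects the g-independent one-step constants and
sup_{g ≤ γ} of the fluctuation normalisations — cell GAPS G-pv24-1). [cite: Balaban1988Convergent, Thm 1 p.262] -/
def LogNormalised (C : B16.Construction) (γ c C₀ : ℝ) : Prop :=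
  ∀ P : B12.RunParams, (C P).flow.InInterval γ P.K → UnitConfigLog (C P) c C₀

/-- HYPOTHESIS on the family: it contains runs with couplings in ]0, γ], a non-empty lattice, and ARBITRARILY SMALL bare
coupling g₀ — as the continuum limit requires under (0.18)/(0.31) [I] (`1/g₀² ≥ 1/g² + βK log L`, K → ∞). [cite: Balaban1987RG1, (0.31) p.259] -/
def SmallCouplingsOccur (C : B16.Construction) (γ : ℝ) : Prop :=
  ∀ δ : ℝ, 0 < δ → ∃ P : B12.RunParams, (C P).flow.InInterval γ P.K ∧ 0 < ((C P).numSites 0 : ℝ) ∧ (C P).flow.g 0 < δ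

/-- (0.1) with γ, E± fixed before the run (`B16.UV01With`) + the step-0 logarithm uniform over the family ⟹ every run of
the family has bare coupling at least `exp(−(E₊ + C₀)/c)`. [folklore] -/
theorem uv01With_forces_g0_floor (C : B16.Construction) (γ c C₀ Em Ep : ℝ) (hc : 0 < c)
    (hnorm : LogNormalised C γ c C₀) (h : B16.UV01With C γ Em Ep) (P : B12.RunParams)
    (hP : (C P).flow.InInterval γ P.K) (hN : 0 < ((C P).numSites 0 : ℝ)) :
    Real.exp (-((Ep + C₀) / c)) ≤ (C P).flow.g 0 :=
  g0_floor_of_uvIneq_zero (C P) c C₀ Em Ep hc (hP 0 (Nat.zero_le _)).1 hN (hnorm P hP)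
    fun V => h P hP 0 (Nat.zero_le _) V

/-- Hence, if small bare couplings occur in the ]0, γ]-family, NO pair `E₋, E₊` serves (0.1) for that γ. [folklore] -/
theorem not_uv01With_of_smallCouplings (C : B16.Construction) (γ c C₀ Em Ep : ℝ) (hc : 0 < c)
    (hnorm : LogNormalised C γ c C₀) (hsmall : SmallCouplingsOccur C γ) : ¬ B16.UV01With C γ Em Ep := by
  intro h
  obtain ⟨P, hP, hN, hlt⟩ := hsmall (Real.exp (-((Ep + C₀) / c))) (Real.exp_pos _)
  exact absurd (uv01With_forces_g0_floor C γ c C₀ Em Ep hc hnorm h P hP hN) (not_le.mpr hlt)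

/-- **The strong reading of (0.1) fails for such a construction**: if for every γ > 0 the step-0 logarithm holds uniformly
on the ]0, γ]-family (with a γ-dependent constant C₀(γ)) and small bare couplings occur in it, then `¬ B16.UVBound01 C`
— whereas the window reading `UVBound01Compact` (§2) and [III]'s `B16.Cor3_250` are untouched.  Bookkeeping over the two
hypotheses; the mathematical input is the printed definition of E (cell GAPS G-pv24-1). [folklore] -/
theorem not_uvBound01_of_smallCouplings (C : B16.Construction) (c : ℝ) (C₀ : ℝ → ℝ) (hc : 0 < c)
    (hnorm : ∀ γ : ℝ, 0 < γ → LogNormalised C γ c (C₀ γ))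
    (hsmall : ∀ γ : ℝ, 0 < γ → SmallCouplingsOccur C γ) : ¬ B16.UVBound01 C := by
  rintro ⟨γ, hγ, Em, Ep, h⟩
  exact not_uv01With_of_smallCouplings C γ c (C₀ γ) Em Ep hc (hnorm γ hγ) (hsmall γ hγ) h

/-- **[III]'s "depending on g_k" is then NECESSARY, with `e₊ → ∞` at small coupling** (the d = 4 twin of [16] p. 256
*"The constant O(1) goes to ∞ as g → 0"*): under `B16.Cor3With C γ em ep` and the step-0 logarithm, `e₊(g₀) ≥ c·log g₀⁻¹
− C₀` at the bare coupling of every run of the family. [cite: Balaban1988Convergent, Cor. 3 (2.50) p.264] -/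
theorem ep_unbounded_of_cor3 (C : B16.Construction) (γ c C₀ : ℝ) (em ep : ℝ → ℝ)
    (hnorm : LogNormalised C γ c C₀) (hcor : B16.Cor3With C γ em ep) (P : B12.RunParams)
    (hP : (C P).flow.InInterval γ P.K) (hN : 0 < ((C P).numSites 0 : ℝ)) :
    c * Real.log ((C P).flow.g 0)⁻¹ - C₀ ≤ ep ((C P).flow.g 0) :=
  ep_lower_of_uvIneq_zero (C P) c C₀ (em ((C P).flow.g 0)) (ep ((C P).flow.g 0)) hN (hnorm P hP)
    fun V => hcor P hP 0 (Nat.zero_le _) V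

/-- The same check over the B10 carrier (cell GAPS G-B10-01, *"Check at k = 0: ρ₀(1) = e^{−E} and, by (64) with (62)
taken literally, −E ≥ 3d(𝔤)|T₁^{(0)}| log g₀⁻¹ − O(1)|T₁^{(0)}|, so 'ρ₀ ≤ exp O(1)|T₁^{(0)}|' fails as ε → 0 for any
g₀-independent O(1)"* — there prose, here kernel): if some step-0 configuration has `ρ₀ ≥ exp((c log g₀⁻¹ − C₀)|T₁^{(0)}|)`
((62) p. 271: *"E^{(k)} = log σ₀|T₁^{(k)*}| + d(𝔤) log g_k |T₁^{(k)*}| + …"*, (64) p. 273, (1) p. 256) and `|T₁^{(0)}| > 0`,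
then (5) at step 0 forces `c log g₀⁻¹ − C₀ ≤ O(1)`. [cite: Balaban1985UV3, (62) p.271] -/
theorem b10_O1_lower_of_bounds5At_zero (D : B10.RunData) (c C₀ O1 : ℝ) (hN : 0 < D.sites 0)
    (hlog : ∃ U₁ : D.Cfg 0, Real.exp ((c * Real.log (D.g 0)⁻¹ - C₀) * D.sites 0) ≤ D.ρ 0 U₁)
    (h5 : B10.Bounds5At D O1 0) : c * Real.log (D.g 0)⁻¹ - C₀ ≤ O1 := by
  obtain ⟨U₁, hU₁⟩ := hlog
  have h := le_trans hU₁ (h5 U₁).2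
  rw [Real.exp_le_exp] at h
  exact le_of_mul_le_mul_right h hN

/-- Through the dictionary the two hypotheses coincide: `UnitConfigLog D c C₀` is the B10-carrier hypothesis for
`toB10 D K`. [folklore] -/
theorem unitConfigLog_iff_toB10 (D : B16.RunData) (K : ℕ) (c C₀ : ℝ) :
    UnitConfigLog D c C₀ ↔
      ∃ U₁ : (toB10 D K).Cfg 0, Real.exp ((c * Real.log ((toB10 D K).g 0)⁻¹ - C₀) * (toB10 D K).sites 0)
        ≤ (toB10 D K).ρ 0 U₁ :=
  Iff.rfl

/-! ## §4. The step-0 logarithm DERIVED from the printed one-step constants (v2; cell GAPS G-pv24-1 made kernel)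

The hypothesis `UnitConfigLog` of §3 is here derived by real arithmetic from LOCATED leaves, each typed over an
abstract per-scale carrier and each a hypothesis (nothing asserted): the one-step constants of (1.15) [III] p. 249
(generic scale: B16 p. 356 displays the same term at step k), the definition of E as their sum over all scales ([III]
p. 262 + p. 254), ρ₀ = exp[−(1/g₀²)A − E] at the unit configuration ([III] Thm 1 p. 262), L⁴-blocking of the site
numbers, couplings in ]0, 1]; plus THREE READER'S ITEMS, labelled as such: the bond count |T^{(j)*}| = 4(|T₁^{(j)}| −
|T₁^{(j+1)}|) for Ω = the whole 4-dimensional periodic lattice ((1.15): *"the number of bonds belonging to Ω₁ minus the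
number of bonds in the set {b₀(c) : c ∈ Ω₁^{(1)}}"*), a LOWER Laplace bound for the gauge-fixing normalisation z of
(0.14)–(0.17) [I] (`log z ≥ d(𝔤) log g_j − C_z`; a larger z only improves the bound), and a ONE-SIDED volume bound
on the fluctuation constants E^{(j+1)}(T^{(j+1)}, g_j, 1) ≤ C_E|T₁^{(j+1)}| (author question (ii) of G-pv24-1; located
support [I] (2.13)–(2.14) p. 268: the constant is log N″_k, the normalised Gaussian expectation of χ_k·exp[an expression
vanishing at g_k = 0]; in [I] it is then normalised away, p. 258; in [III] it is carried into E, p. 254).  Output: `−E ≥ (3(1 − L⁻⁴)d(𝔤)·log g₀⁻¹ − C₀)·|T₁^{(0)}|` with the explicit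
`C₀ = 4|log σ₀| + C_z + C_E/(L⁴ − 1)` (`negE_lower`), hence `UnitConfigLog D (3(1 − L⁻⁴)d(𝔤)) C₀` (`unitConfigLog_of_leaves`)
and, with §3, `E₊ ≥ 3(1 − L⁻⁴)d(𝔤) log g₀⁻¹ − C₀` under (0.1) (`ep_lower_of_leaves`). -/

/-- Per-scale carrier for the vacuum-energy bookkeeping of [III] §1–§2: `K` steps; `N j = |T₁^{(j)}|` (sites of
T^{(j)}); `g j = g_j`; `dg = d(𝔤)`; `L`; `logσ₀ = log σ₀` ((2.8) [I]); `Tstar j = |T^{(j)*}|` of (1.15); `logz j = log z`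
at scale j ((0.15)–(0.17) [I]); `Efl j = E^{(j+1)}(T^{(j+1)}, g_j, 1)` (p. 254); `e j` = the scale-j one-step vacuum
energy expression; `E` = the initial constant of Thm 1 p. 262. Reader-chosen packaging. [cite: Balaban1988Convergent, (1.15) p.249] -/
structure CountertermData where
  K : ℕ
  N : ℕ → ℝ
  g : ℕ → ℝ
  dg : ℕ
  L : ℕ
  logσ₀ : ℝ
  Tstar : ℕ → ℝ
  logz : ℕ → ℝ
  Efl : ℕ → ℝ
  e : ℕ → ℝ
  E : ℝ

namespace CountertermData

variable (S : CountertermData)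

/-- LEAF (1.15) p. 249 [7] + p. 254 [12], generic scale j (B16 p. 356 [2] displays the same term at step k:
*"(−½d(g) log g_k⁻² + log σ₀)|Λ^{(k)}∖G₀|"*): the scale-j expression subtracted from E is the sum of *"the constants in
the first exponential in (1.15)"* — *"+ log g₀ d(𝐠)|Ω₁*| + log σ₀|Ω₁*| − log z(L⁴ − 1)|Ω₁^{(1)}|"* with Ω₁ = the whole
lattice — *"and the constant E^{(1)}(Λ₁, g₀, 1)"*.  Hypothesis, never asserted. [cite: Balaban1988Convergent, (1.15) p.249] -/
def OneStep115 : Prop :=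
  ∀ j, j < S.K → S.e j = Real.log (S.g j) * S.dg * S.Tstar j + S.logσ₀ * S.Tstar j
    - S.logz j * (((S.L : ℝ) ^ 4 - 1) * S.N (j + 1)) + S.Efl j

/-- LEAF p. 262 [20]: *"This initial constant is defined in fact as a sum of all such expressions for all the lattices
T^{(k)} as the small field regions."* Hypothesis. [cite: Balaban1988Convergent, Thm 1 p.262] -/
def ESum : Prop := S.E = ∑ j ∈ Finset.range S.K, S.e j

/-- READER'S COUNT (labelled): for Ω₁ = the whole 4-dimensional periodic lattice, *"the number of bonds belonging to Ω₁
minus the number of bonds in the set {b₀(c) : c ∈ Ω₁^{(1)}}"* = 4|T₁^{(j)}| − 4|T₁^{(j+1)}| (d bonds per site on a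
periodic lattice; c ↦ b₀(c) injective on coarse bonds). Hypothesis. [folklore] -/
def TstarCount : Prop := ∀ j, j < S.K → S.Tstar j = 4 * S.N j - 4 * S.N (j + 1)

/-- LEAF (blocking, [III] p. 245 / [I] (0.3)): T^{(j+1)} is the lattice of L-blocks of T^{(j)}, so
`|T₁^{(j+1)}|·L⁴ = |T₁^{(j)}|`. Hypothesis. [cite: Balaban1988Convergent, p.245] -/
def Blocking : Prop := ∀ j, S.N (j + 1) * (S.L : ℝ) ^ 4 = S.N j

/-- READER'S ITEM (labelled; elementary Laplace LOWER bound, not printed): the gauge-fixing normalisation z of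
(0.14)–(0.15) [I] p. 254 [6] — *"(1/z)∫du(x) exp[−(1/α)[1 − Re tr u(x)]]χ({|u(x) − 1| < ε₀}) = 1"*, *"where z is defined
by the last integral"* (p. 255), with α = g_k² as displayed in the gauge-fixing exponent `−(1/g₀²)Σ_{y∈T^{(1)}}Σ_{x∈B(y),x≠y}
[1 − Re tr U(y, x)]` of (0.17) (and `1/g_k²` in (0.19)) — satisfies `log z ≥ d(𝔤)·log g_j − C_z` (restrict the Haar
integral to a g_j-ball at the identity, where the weight is ≥ e^{−O(1)}).  If z is larger every bound below improves.
Hypothesis. [cite: Balaban1987RG1, (0.14)–(0.17) pp.254–255] -/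
def ZLower (Cz : ℝ) : Prop := ∀ j, j < S.K → (S.dg : ℝ) * Real.log (S.g j) - Cz ≤ S.logz j

/-- READER'S ITEM (labelled; author question (ii) of cell GAPS G-pv24-1 — no printed statement bounds this constant),
ONE-SIDED (only the upper bound is used): `E^{(j+1)}(T^{(j+1)}, g_j, 1) ≤ C_E |T₁^{(j+1)}|` uniformly in the scale and in
g_j.  LOCATED SUPPORT in [I]: p. 268 [20], after (2.13) `E^{(k+1)}(g_k, U_{k+1}) = log ∫dμ_{C^{(k)}}(B)χ_k exp[P^{(k)}(g_k,
U_{k+1}, B) + {…}]`: *"Let us remark that the expression under the exponential above vanishes at g_k = 0, and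
log N″_k = E^{(k+1)}(g_k, 1). (2.14)"*, with *"the normalization constant N″_k is equal to the integral above at
U_{k+1} = 1"* — so the constant is the logarithm of a NORMALISED Gaussian expectation of χ_k·exp[an expression vanishing
at g_k = 0], and any bound `sup_{χ_k} (P^{(k)}(g_k, 1, B) + {…}) ≤ C_E|T₁^{(k+1)}|` uniform in g_k ≤ γ gives the item;
in [I]'s final bookkeeping the constant is then normalised away — p. 258 [10]: *"In fact there is one more
renormalization counterterm needed, it is a vacuum energy counterterm. It is contained in the normalization factors in
the integrals (0.17), (0.19), hence we may assume that it is included already in the definition of the function E^{(j)},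
and E^{(j)}(1) = 0."* — while [III] carries it into E (p. 254 [12]: E₁ = E minus the constants of (1.15) *"and the
constant E^{(1)}(Λ₁, g₀, 1)"*, the function E^{(1)}(Λ₁, ·) *"coincides with the corresponding function constructed in
[I], if the last is suitably restricted"*).  Hypothesis. [cite: Balaban1987RG1, (2.13)–(2.14) p.268] -/
def EflBound (CE : ℝ) : Prop := ∀ j, j < S.K → S.Efl j ≤ CE * S.N (j + 1)

/-- The couplings of the scales used lie in ]0, 1] (B16 Thm 1: ]0, γ], γ small). Hypothesis. [cite: Balaban1989LargeFieldII, Thm 1 p.355] -/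
def SmallCouplings : Prop := ∀ j, j < S.K → 0 < S.g j ∧ S.g j ≤ 1

/-- Telescoping under blocking: `(L⁴ − 1)·Σ_{j<K} |T₁^{(j+1)}| = |T₁^{(0)}| − |T₁^{(K)}|`. Real arithmetic. [folklore] -/
theorem sum_succ_sites_eq (hB : S.Blocking) :
    (((S.L : ℝ) ^ 4) - 1) * ∑ j ∈ Finset.range S.K, S.N (j + 1) = S.N 0 - S.N S.K := by
  have h1 : ((S.L : ℝ) ^ 4) * ∑ j ∈ Finset.range S.K, S.N (j + 1) = ∑ j ∈ Finset.range S.K, S.N j := by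
    rw [Finset.mul_sum]
    refine Finset.sum_congr rfl fun j _ => ?_
    rw [mul_comm]
    exact hB j
  have h2 : ∑ j ∈ Finset.range S.K, S.N j
      = ∑ j ∈ Finset.range S.K, S.N (j + 1) + S.N 0 - S.N S.K := by
    have h3 : ∑ j ∈ Finset.range (S.K + 1), S.N j = ∑ j ∈ Finset.range S.K, S.N (j + 1) + S.N 0 :=
      Finset.sum_range_succ' (fun j => S.N j) S.K
    have h4 : ∑ j ∈ Finset.range (S.K + 1), S.N j = ∑ j ∈ Finset.range S.K, S.N j + S.N S.K :=
      Finset.sum_range_succ (fun j => S.N j) S.K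
    linarith
  rw [sub_mul, one_mul, h1, h2]
  ring

/-- Under blocking with `L ≥ 2` and non-negative site numbers: `Σ_{j<K} |T₁^{(j+1)}| ≤ |T₁^{(0)}|/(L⁴ − 1)`. [folklore] -/
theorem sum_succ_sites_le (hB : S.Blocking) (hL : 2 ≤ S.L) (hN : ∀ j, 0 ≤ S.N j) :
    ∑ j ∈ Finset.range S.K, S.N (j + 1) ≤ S.N 0 / (((S.L : ℝ) ^ 4) - 1) := by
  have hL' : (2 : ℝ) ≤ (S.L : ℝ) := by exact_mod_cast hL
  have hL4 : (16 : ℝ) ≤ (S.L : ℝ) ^ 4 := by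
    have h := pow_le_pow_left₀ (by norm_num : (0 : ℝ) ≤ 2) hL' 4
    norm_num at h
    exact h
  have hpos : 0 < ((S.L : ℝ) ^ 4) - 1 := by linarith
  rw [le_div_iff₀ hpos, mul_comm, sum_succ_sites_eq S hB]
  linarith [hN S.K]

/-- Site differences are non-negative under blocking (`L ≥ 1`, `N ≥ 0`): `|T₁^{(j)}| − |T₁^{(j+1)}| = (L⁴ − 1)|T₁^{(j+1)}| ≥ 0`. [folklore] -/
theorem sites_sub_eq (hB : S.Blocking) (j : ℕ) :
    S.N j - S.N (j + 1) = (((S.L : ℝ) ^ 4) - 1) * S.N (j + 1) := by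
  have := hB j
  linarith [this]

/-- **The one-step lower bound** at scale j: from (1.15) + the bond count + the Laplace lower bound for z + the volume
bound on E^{(j+1)}(1):
`−e_j ≥ 3·d(𝔤)·log g_j⁻¹·(|T₁^{(j)}| − |T₁^{(j+1)}|) − (4|log σ₀| + C_z)(|T₁^{(j)}| − |T₁^{(j+1)}|) − C_E|T₁^{(j+1)}|`
— the coefficient 3 = 4 (bond variables) − 1 (gauge-fixed site variables per unit of |T₁^{(j)}| − |T₁^{(j+1)}|).
Real arithmetic. [folklore] -/
theorem negStep_lower (Cz CE : ℝ) (h115 : S.OneStep115) (hT : S.TstarCount) (hB : S.Blocking) (hz : S.ZLower Cz)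
    (hE : S.EflBound CE) (hL : 1 ≤ S.L) (hN : ∀ j, 0 ≤ S.N j) (j : ℕ) (hj : j < S.K) :
    3 * (S.dg : ℝ) * Real.log (S.g j)⁻¹ * (S.N j - S.N (j + 1))
      - (4 * |S.logσ₀| + Cz) * (S.N j - S.N (j + 1)) - CE * S.N (j + 1) ≤ -S.e j := by
  have hΔ : 0 ≤ S.N j - S.N (j + 1) := by
    rw [sites_sub_eq S hB j]
    have hL' : (1 : ℝ) ≤ (S.L : ℝ) := by exact_mod_cast hL
    have : (1 : ℝ) ≤ (S.L : ℝ) ^ 4 := one_le_pow₀ hL'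
    exact mul_nonneg (by linarith) (hN (j + 1))
  have he := h115 j hj
  have hTj := hT j hj
  have hzj := hz j hj
  have hEj := hE j hj
  have hsub := sites_sub_eq S hB j
  rw [Real.log_inv]
  have hσ : -(S.logσ₀ * S.Tstar j) ≥ -(4 * |S.logσ₀| * (S.N j - S.N (j + 1))) := by
    rw [hTj]
    have h1 : S.logσ₀ * (4 * S.N j - 4 * S.N (j + 1)) ≤ |S.logσ₀| * (4 * S.N j - 4 * S.N (j + 1)) :=
      mul_le_mul_of_nonneg_right (le_abs_self _) (by linarith)
    linarith
  -- the z-term: logz j * ((L⁴ − 1) N (j+1)) = logz j * (N j − N (j+1)) ≥ (dg log g_j − Cz)(N j − N (j+1))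
  have hzterm : ((S.dg : ℝ) * Real.log (S.g j) - Cz) * (S.N j - S.N (j + 1))
      ≤ S.logz j * ((((S.L : ℝ) ^ 4) - 1) * S.N (j + 1)) := by
    rw [← hsub]
    exact mul_le_mul_of_nonneg_right hzj hΔ
  rw [he, hTj]
  rw [hTj] at hσ
  linarith [hzterm, hσ, hEj, hΔ]

/-- **−E bounded below** (`K ≥ 1`, `L ≥ 2`): summing `negStep_lower` over the scales, keeping the logarithm only at
j = 0 (for j ≥ 1 it is ≥ 0 since g_j ≤ 1), telescoping the site differences and bounding `Σ_{j<K}|T₁^{(j+1)}| ≤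
|T₁^{(0)}|/(L⁴ − 1)`:  `−E ≥ (3(1 − L⁻⁴)·d(𝔤)·log g₀⁻¹ − C₀)·|T₁^{(0)}|`, `C₀ = 4|log σ₀| + C_z + C_E/(L⁴ − 1)`.
Real arithmetic over the leaves. [folklore] -/
theorem negE_lower (Cz CE : ℝ) (h115 : S.OneStep115) (hsum : S.ESum) (hT : S.TstarCount) (hB : S.Blocking)
    (hz : S.ZLower Cz) (hE : S.EflBound CE) (hg : S.SmallCouplings) (hL : 2 ≤ S.L) (hN : ∀ j, 0 ≤ S.N j)
    (hK : 1 ≤ S.K) (hCz : 0 ≤ 4 * |S.logσ₀| + Cz) (hCE : 0 ≤ CE) :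
    (3 * (1 - 1 / (S.L : ℝ) ^ 4) * S.dg * Real.log (S.g 0)⁻¹ - (4 * |S.logσ₀| + Cz + CE / (((S.L : ℝ) ^ 4) - 1)))
      * S.N 0 ≤ -S.E := by
  have hL1 : 1 ≤ S.L := le_trans (by norm_num) hL
  have hL' : (2 : ℝ) ≤ (S.L : ℝ) := by exact_mod_cast hL
  have hL4 : (16 : ℝ) ≤ (S.L : ℝ) ^ 4 := by
    have h := pow_le_pow_left₀ (by norm_num : (0 : ℝ) ≤ 2) hL' 4
    norm_num at h
    exact h
  have hpos : 0 < ((S.L : ℝ) ^ 4) - 1 := by linarith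
  have hLne : ((S.L : ℝ) ^ 4) ≠ 0 := by positivity
  -- per-scale lower bounds, with the logarithm dropped for every j (it is ≥ 0) except that we keep it at j = 0
  have hstep : ∀ j ∈ Finset.range S.K,
      -((4 * |S.logσ₀| + Cz) * (S.N j - S.N (j + 1))) - CE * S.N (j + 1)
        + (if j = 0 then 3 * (S.dg : ℝ) * Real.log (S.g 0)⁻¹ * (S.N 0 - S.N 1) else 0) ≤ -S.e j := by
    intro j hjm
    have hj : j < S.K := Finset.mem_range.mp hjm
    have hmain := negStep_lower S Cz CE h115 hT hB hz hE hL1 hN j hj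
    have hlog : 0 ≤ Real.log (S.g j)⁻¹ := by
      apply Real.log_nonneg
      obtain ⟨h0, h1⟩ := hg j hj
      exact (one_le_inv₀ h0).mpr h1
    have hΔ : 0 ≤ S.N j - S.N (j + 1) := by
      rw [sites_sub_eq S hB j]; exact mul_nonneg hpos.le (hN (j + 1))
    have hprod : 0 ≤ 3 * (S.dg : ℝ) * Real.log (S.g j)⁻¹ * (S.N j - S.N (j + 1)) := by positivity
    by_cases hj0 : j = 0
    · subst hj0
      simp only [if_true]
      linarith
    · simp only [hj0, if_false]
      linarith
  have hsumle := Finset.sum_le_sum hstep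
  -- evaluate the left-hand sum
  rw [Finset.sum_add_distrib, Finset.sum_sub_distrib, Finset.sum_ite_eq' (Finset.range S.K) 0,
    if_pos (Finset.mem_range.mpr hK)] at hsumle
  have htel : ∑ j ∈ Finset.range S.K, -((4 * |S.logσ₀| + Cz) * (S.N j - S.N (j + 1)))
      = -((4 * |S.logσ₀| + Cz) * (S.N 0 - S.N S.K)) := by
    have : ∀ j ∈ Finset.range S.K, -((4 * |S.logσ₀| + Cz) * (S.N j - S.N (j + 1)))
        = (4 * |S.logσ₀| + Cz) * (S.N (j + 1) - S.N j) := fun j _ => by ring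
    rw [Finset.sum_congr rfl this, ← Finset.mul_sum, Finset.sum_range_sub (fun j => S.N j) S.K]
    ring
  have hCEsum : ∑ j ∈ Finset.range S.K, CE * S.N (j + 1) ≤ CE * (S.N 0 / (((S.L : ℝ) ^ 4) - 1)) := by
    rw [← Finset.mul_sum]
    exact mul_le_mul_of_nonneg_left (sum_succ_sites_le S hB hL hN) hCE
  have hEsum : ∑ j ∈ Finset.range S.K, -S.e j = -S.E := by
    rw [Finset.sum_neg_distrib, hsum]
  rw [htel, hEsum] at hsumle
  -- N 0 − N 1 = (1 − L⁻⁴) N 0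
  have h01 : S.N 0 - S.N 1 = (1 - 1 / (S.L : ℝ) ^ 4) * S.N 0 := by
    have := hB 0
    field_simp
    linarith [this]
  rw [h01] at hsumle
  have hNK := hN S.K
  have hlog0 : 0 ≤ Real.log (S.g 0)⁻¹ := by
    apply Real.log_nonneg
    obtain ⟨h0, h1⟩ := hg 0 (lt_of_lt_of_le zero_lt_one hK)
    exact (one_le_inv₀ h0).mpr h1
  have hdiv : CE / (((S.L : ℝ) ^ 4) - 1) * S.N 0 = CE * (S.N 0 / (((S.L : ℝ) ^ 4) - 1)) := by
    field_simp
  nlinarith [hsumle, hCEsum, hNK, hdiv, hCz, hN 0]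

end CountertermData

/-- **`UnitConfigLog` from the leaves** (G-pv24-1 made kernel modulo located hypotheses): if a d = 4 run `D` carries
counterterm data `S` with `S.N 0 = |T₁^{(0)}|`, `S.g 0 = g₀`, satisfying the located leaves + the three labelled
reader's items, and some step-0 configuration has `ρ₀ ≥ e^{−E}` ([III] Thm 1 p. 262: `ρ₀ = exp[−(1/g₀²)A − E]`, `A(1) = 0` at
the unit configuration), then `UnitConfigLog D (3(1 − L⁻⁴)d(𝔤)) C₀` with `C₀ = 4|log σ₀| + C_z + C_E/(L⁴ − 1)`. [cite: Balaban1988Convergent, Thm 1 p.262] -/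
theorem unitConfigLog_of_leaves (D : B16.RunData) (S : CountertermData) (Cz CE : ℝ)
    (hN0 : S.N 0 = (D.numSites 0 : ℝ)) (hg0 : S.g 0 = D.flow.g 0)
    (hρ : ∃ V₁ : D.Cfg 0, Real.exp (-S.E) ≤ D.ρ 0 V₁)
    (h115 : S.OneStep115) (hsum : S.ESum) (hT : S.TstarCount) (hB : S.Blocking) (hz : S.ZLower Cz)
    (hE : S.EflBound CE) (hg : S.SmallCouplings) (hL : 2 ≤ S.L) (hN : ∀ j, 0 ≤ S.N j) (hK : 1 ≤ S.K)
    (hCz : 0 ≤ 4 * |S.logσ₀| + Cz) (hCE : 0 ≤ CE) :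
    UnitConfigLog D (3 * (1 - 1 / (S.L : ℝ) ^ 4) * S.dg) (4 * |S.logσ₀| + Cz + CE / (((S.L : ℝ) ^ 4) - 1)) := by
  obtain ⟨V₁, hV₁⟩ := hρ
  refine ⟨V₁, le_trans (Real.exp_le_exp.mpr ?_) hV₁⟩
  have h := CountertermData.negE_lower S Cz CE h115 hsum hT hB hz hE hg hL hN hK hCz hCE
  rw [hN0, hg0] at h
  exact h

/-- **E₊ of (0.1) at step 0 from the leaves**: under the same located hypotheses and a non-empty lattice, the upper half
of (0.1) at k = 0 forces `E₊ ≥ 3(1 − L⁻⁴)·d(𝔤)·log g₀⁻¹ − C₀` — for SU(2) (d(𝔤) = 3) and L ≥ 2 at least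
`8.4·log g₀⁻¹ − C₀`.  Composition of `unitConfigLog_of_leaves` with `ep_lower_of_uvIneq_zero`. [cite: Balaban1989LargeFieldII, (0.1) pp.355–356] -/
theorem ep_lower_of_leaves (D : B16.RunData) (S : CountertermData) (Cz CE Em Ep : ℝ)
    (hN0 : S.N 0 = (D.numSites 0 : ℝ)) (hg0 : S.g 0 = D.flow.g 0) (hNpos : 0 < (D.numSites 0 : ℝ))
    (hρ : ∃ V₁ : D.Cfg 0, Real.exp (-S.E) ≤ D.ρ 0 V₁)
    (h115 : S.OneStep115) (hsum : S.ESum) (hT : S.TstarCount) (hB : S.Blocking) (hz : S.ZLower Cz)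
    (hE : S.EflBound CE) (hg : S.SmallCouplings) (hL : 2 ≤ S.L) (hN : ∀ j, 0 ≤ S.N j) (hK : 1 ≤ S.K)
    (hCz : 0 ≤ 4 * |S.logσ₀| + Cz) (hCE : 0 ≤ CE) (h01 : ∀ V : D.Cfg 0, B16.UVIneq D 0 V Em Ep) :
    3 * (1 - 1 / (S.L : ℝ) ^ 4) * S.dg * Real.log (D.flow.g 0)⁻¹
      - (4 * |S.logσ₀| + Cz + CE / (((S.L : ℝ) ^ 4) - 1)) ≤ Ep :=
  ep_lower_of_uvIneq_zero D _ _ Em Ep hNpos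
    (unitConfigLog_of_leaves D S Cz CE hN0 hg0 hρ h115 hsum hT hB hz hE hg hL hN hK hCz hCE) h01

/-- Numeric instance of the coefficient: for SU(2) (`d(𝔤) = 3`) and `L = 2`, `3(1 − L⁻⁴)d(𝔤) = 135/16 = 8.4375`. [folklore] -/
example : 3 * (1 - 1 / (2 : ℝ) ^ 4) * 3 = 135 / 16 := by norm_num

/-! ## §5. By-name bridge: the compact-window reading + the (2.6)-floor ⇒ the bare-coupling reading (v2.2, append-only)

`B16.uvBound01PerBare_of_window_floor` (sibling `B16`, revision v7) carries the window hypothesis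
`∀ gmin, 0 < gmin → gmin ≤ γ → ∃ Em Ep, <UV01Window C γ gmin Em Ep unfolded>` because `B16` cannot import this module;
here `UV01Window` / `UVBound01Compact` (§2) are folded back by name — the proofs are definitional unfolding, no content.
THE FLOOR IS A HYPOTHESIS: the last member of (2.6) [III] p. 255 [PDF 13] at m = 0 — print (render read as image):
*"The coupling constants g_j satisfy the inequalities … g_m ≦ (1+β₀)g_n , (2.6) where n > m, and β₀ > 0 can be chosen
arbitrarily small, if g is sufficiently small. The inequalities follow from the renormalization group equations (0.20) [I],
and from the properties of the β-functions."* — printed, UNPROVED in print (no proof is printed beyond that sentence),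
the cell's located step (i) (`B14.FlowIneq26`, cell `MISSING-B14.md`); typed here, as in `B16`, run by run along the
]0, γ]-family: `∀ P, InInterval γ P.K → ∀ k ≤ P.K, g_0 ≤ (1+β₀) g_k` with β₀ ≥ 0.  It is load-bearing: without it
`UVBound01Compact` does not give `B16.UVBound01PerBare` on the carrier (kernel counter-model
`B16PerBareCounter.compact_not_implies_perBare`, reader group r2 gen 9 — that module imports this one, so it is quoted by
name only).  Nothing printed is asserted in this section. -/

/-- **Compact window + (2.6)-floor ⇒ bare-coupling reading**, by name: `UVBound01Compact C` and, for every γ > 0, the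
floor `g_0 ≤ (1+β₀) g_k` (k ≤ K) along every run of the ]0, γ]-family give `B16.UVBound01PerBare C`.  One-line fold of
`UV01Window` into `B16.uvBound01PerBare_of_window_floor`; the floor is demanded at every γ because the window's γ is
hidden in the `∃` of `UVBound01Compact` (the fixed-γ form is `uvPerBare_of_window_floor`). [cite: Balaban1988Convergent, (2.6) p.255] -/
theorem uvPerBare_of_uvCompact_floor (C : B16.Construction) (β₀ : ℝ) (hβ₀ : 0 ≤ β₀) (h : UVBound01Compact C)
    (hfloor : ∀ γ : ℝ, 0 < γ → ∀ P : B12.RunParams, (C P).flow.InInterval γ P.K →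
      ∀ k, k ≤ P.K → (C P).flow.g 0 ≤ (1 + β₀) * (C P).flow.g k) :
    B16.UVBound01PerBare C := by
  obtain ⟨γ, hγ, hw⟩ := h
  exact B16.uvBound01PerBare_of_window_floor C γ hγ β₀ hβ₀ hw (hfloor γ hγ)

/-- The same with the window statement at ONE fixed γ (`∀ gmin ∈ ]0, γ], ∃ E±, UV01Window C γ gmin E₋ E₊`) and the floor
demanded along the ]0, γ]-family only — literally `B16.uvBound01PerBare_of_window_floor` with `UV01Window` folded. [folklore] -/
theorem uvPerBare_of_window_floor (C : B16.Construction) (γ : ℝ) (hγ : 0 < γ) (β₀ : ℝ) (hβ₀ : 0 ≤ β₀)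
    (hw : ∀ gmin : ℝ, 0 < gmin → gmin ≤ γ → ∃ Em Ep : ℝ, UV01Window C γ gmin Em Ep)
    (hfloor : ∀ P : B12.RunParams, (C P).flow.InInterval γ P.K →
      ∀ k, k ≤ P.K → (C P).flow.g 0 ≤ (1 + β₀) * (C P).flow.g k) :
    B16.UVBound01PerBare C :=
  B16.uvBound01PerBare_of_window_floor C γ hγ β₀ hβ₀ hw hfloor

/-- The chain down to the per-run reading: compact window + (2.6)-floor ⇒ `B16.UVBound01PerRun` (through
`B16.uvBound01PerRun_of_perBare`).  With `uvCompact_of_uvBound01` (§2) the four typed readings of the coupling clause are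
ordered by NAMED theorems: `B16.UVBound01 ⇒ UVBound01Compact ⇒[(2.6)-floor] B16.UVBound01PerBare ⇒ B16.UVBound01PerRun`. [folklore] -/
theorem uvPerRun_of_uvCompact_floor (C : B16.Construction) (β₀ : ℝ) (hβ₀ : 0 ≤ β₀) (h : UVBound01Compact C)
    (hfloor : ∀ γ : ℝ, 0 < γ → ∀ P : B12.RunParams, (C P).flow.InInterval γ P.K →
      ∀ k, k ≤ P.K → (C P).flow.g 0 ≤ (1 + β₀) * (C P).flow.g k) :
    B16.UVBound01PerRun C :=
  B16.uvBound01PerRun_of_perBare C (uvPerBare_of_uvCompact_floor C β₀ hβ₀ h hfloor)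

/-- The whole chain from the legacy strong reading: `B16.UVBound01 ⇒ B16.UVBound01PerRun` factors through §2 and §5
(sanity composition; `B16` has the direct implications `uvBound01PerBare_of_uvBound01`, `uvBound01PerRun_of_perBare`). [folklore] -/
theorem uvPerRun_of_uvBound01_floor (C : B16.Construction) (β₀ : ℝ) (hβ₀ : 0 ≤ β₀) (h : B16.UVBound01 C)
    (hfloor : ∀ γ : ℝ, 0 < γ → ∀ P : B12.RunParams, (C P).flow.InInterval γ P.K →
      ∀ k, k ≤ P.K → (C P).flow.g 0 ≤ (1 + β₀) * (C P).flow.g k) :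
    B16.UVBound01PerRun C :=
  uvPerRun_of_uvCompact_floor C β₀ hβ₀ (uvCompact_of_uvBound01 C h) hfloor

end Literature.MathematicalPhysics.QuantumFieldTheory.Balaban1983to89.B16B10Shape
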